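import Literature.AnabelianGeometry.SemiGraphs.TemperedQuasiGeometricOfShadows
import Literature.AnabelianGeometry.SemiGraphs.TemperedReconstructionR0CompatProofsAt
import Literature.AnabelianGeometry.SemiGraphs.TemperedReconstructionR2bHomProofs
import Literature.AnabelianGeometry.SemiGraphs.TemperedThm37OfCompactInVerticialAt
import HarnessLib

/-!
# [SemiAnbd] Cor. 3.9 (a), compatible reading, AT ONE PAIR — the compatibility shadow WITH OPENNESS of a
# homomorphism induced by a locally open morphism (the chart half of the producer binder `hιgeomC`; proof-only)

Mochizuki, *Semi-graphs of anabelioids*, Publ. RIMS **42** (2006), §3, Cor. 3.9, proof, manuscript p. 42 ("any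
locally open morphism … determines a morphism of temperoids … whose quasi-geometricity follows by 'substituting'
the equivalences of Theorem 3.7, (iv), into Definition 3.8") [cite: MochizukiSemiAnbd2006, Cor 3.9 p.42]; §5
Thm 5.4 (iii) p. 66 ("entirely parallel").

PROOF-ONLY (cell abc-iut, layer L3, row T54-7c sequel; seat abc-iut-w4-d083; no definition).  The umbrella
v3c of [SemiAnbd] Thm 5.4 (iii) (abc-iut-w5-d141) discharges its clause-1 binder `h1c` through
`Thm54iii.h1c_of_iota` (`ArithQuasiGeometricCompatOfIota.lean`) from ONE datum `hιgeomC` about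
`ι g = B^temp(g)|_{geom}`: two distinct geometric verticial subgroups meeting non-trivially are mapped ONTO OPEN
subgroups of two DISTINCT geometric verticial subgroups, respectively.  This file proves the CHART-LEVEL form
of that datum for any homomorphism `φ : π₁^temp(G) → π₁^temp(H)` compatible on verticial and edge homomorphisms
with a locally open morphism of semi-graphs of anabelioids `F : G → H`
(`compatOpenShadow_of_compatVAt`): the compatibility clause of (R0′)
`isCompatiblyQuasiGeometric_of_compatAt` gives distinct verticial hosts CONTAINING the images, the literal
clause gives SOME verticial host onto an open subgroup of which the image maps, and the host of an open image
is unique (Thm 3.7 (ii), `host_eq_of_mapsOnto`) — so the two coincide.  Modulo Thm 3.7 (iii) at `G` and (iv) at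
`G`, `H` (per-graph forms); the packaged form `…_of_compactInVerticialAt` takes (iii) at `G` and `H` only.  The
kernel-level transport to the producer's `hιgeomC` is the producer's (symmetric to
`ArithCor39cTransport.lean`).  Nothing here bears on [IUTchIII] Cor. 3.12; typed ≠ discharged.
-/

namespace Literature.AnabelianGeometry.SemiGraphs

namespace ProfiniteSemiGraph

universe u

variable {𝒢 ℋ : ProfiniteSemiGraph.{u}}

/-- **Cor. 3.9 (a), compatible reading, with openness, AT the pair `(G, H)`**: a homomorphism
`φ : π₁^temp(G) → π₁^temp(H)` compatible on verticial and edge homomorphisms with a locally open morphism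
`F : G → H` carries two DISTINCT verticial subgroups of `π₁^temp(G)` with non-trivial intersection ONTO OPEN
subgroups of two DISTINCT verticial subgroups of `π₁^temp(H)`, respectively — the chart-level form of the
producer datum `hιgeomC` of `Thm54iii.h1c_of_iota`.  From Thm 3.7 (i), (ii), (iii) at `G`, (iv) at `G` and
at `H`. [cite: MochizukiSemiAnbd2006, Cor 3.9 p.42] -/
theorem compatOpenShadow_of_compatVAt (h37i : VerticialInjective.{u}) (h37ii : VerticialDistinct.{u})
    (h𝒢iii : CompactInVerticialAt 𝒢) (h37iv𝒢 : MaximalCompactIffVerticialAt 𝒢)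
    (h37ivℋ : MaximalCompactIffVerticialAt ℋ) (h𝒢 : Cor39Hypotheses 𝒢) (hℋ : Cor39Hypotheses ℋ)
    (c𝒢 : TemperedPiChart 𝒢) (cℋ : TemperedPiChart ℋ) (F : Hom 𝒢 ℋ) (φ : c𝒢.G →ₜ* cℋ.G)
    (hF : F.IsLocallyOpen) (hV : F.CompatV c𝒢 cℋ φ) (hE : F.CompatE c𝒢 cℋ φ) :
    ∀ (v₁ v₂ : 𝒢.graph.Vertex) (K₁ H₁ : Subgroup c𝒢.G), K₁ ∈ verticialSubgroups c𝒢 v₁ →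
      H₁ ∈ verticialSubgroups c𝒢 v₂ → K₁ ≠ H₁ → K₁ ⊓ H₁ ≠ ⊥ →
      ∃ (w₁ w₂ : ℋ.graph.Vertex) (K₂ H₂ : Subgroup cℋ.G), K₂ ∈ verticialSubgroups cℋ w₁ ∧
        H₂ ∈ verticialSubgroups cℋ w₂ ∧ K₂ ≠ H₂ ∧ MapsOntoOpenSubgroupOf φ.toMonoidHom K₁ K₂ ∧
        MapsOntoOpenSubgroupOf φ.toMonoidHom H₁ H₂ := by
  intro v₁ v₂ K₁ H₁ hK₁ hH₁ hne hnt
  have hq : IsCompatiblyQuasiGeometric φ :=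
    isCompatiblyQuasiGeometric_of_compatAt h37i h37ii h𝒢iii h37iv𝒢 h37ivℋ h𝒢 hℋ c𝒢 cℋ F φ hF hV hE
  obtain ⟨hVsh, -, hCsh⟩ :=
    shadows_of_isCompatiblyQuasiGeometric h37iv𝒢 h37ivℋ h𝒢.thm37Hypotheses hℋ.thm37Hypotheses c𝒢 cℋ hq
  -- distinct verticial hosts CONTAINING the two images (the compatibility clause)
  obtain ⟨w₁, w₂, K₂, H₂, hK₂, hH₂, hne₂, hle₁, hle₂⟩ := hCsh v₁ v₂ K₁ H₁ hK₁ hH₁ hne hnt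
  -- SOME verticial host onto an open subgroup of which each image maps (the literal clause)
  obtain ⟨u₁, K₂', hK₂', hm₁⟩ := hVsh v₁ K₁ hK₁
  obtain ⟨u₂, H₂', hH₂', hm₂⟩ := hVsh v₂ H₁ hH₁
  -- the host of an open image is unique (Thm 3.7 (ii))
  have e₁ : K₂ = K₂' :=
    host_eq_of_mapsOnto h37ii hℋ.thm37Hypotheses cℋ φ.toMonoidHom hK₂' hm₁ hK₂ hle₁
  have e₂ : H₂ = H₂' :=
    host_eq_of_mapsOnto h37ii hℋ.thm37Hypotheses cℋ φ.toMonoidHom hH₂' hm₂ hH₂ hle₂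
  subst e₁ e₂
  exact ⟨w₁, w₂, K₂, H₂, hK₂, hH₂, hne₂, hm₁, hm₂⟩

/-- **The same from Thm 3.7 (iii) AT `G` AND AT `H` alone** ((i), (ii) discharged in the tree; (iv) at a graph
from (iii) at that graph, abc-iut-w4-d075). [cite: MochizukiSemiAnbd2006, Cor 3.9 p.42] -/
theorem compatOpenShadow_of_compatVAt_of_compactInVerticialAt (h𝒢iii : CompactInVerticialAt 𝒢)
    (hℋiii : CompactInVerticialAt ℋ) (h𝒢 : Cor39Hypotheses 𝒢) (hℋ : Cor39Hypotheses ℋ)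
    (c𝒢 : TemperedPiChart 𝒢) (cℋ : TemperedPiChart ℋ) (F : Hom 𝒢 ℋ) (φ : c𝒢.G →ₜ* cℋ.G)
    (hF : F.IsLocallyOpen) (hV : F.CompatV c𝒢 cℋ φ) (hE : F.CompatE c𝒢 cℋ φ) :
    ∀ (v₁ v₂ : 𝒢.graph.Vertex) (K₁ H₁ : Subgroup c𝒢.G), K₁ ∈ verticialSubgroups c𝒢 v₁ →
      H₁ ∈ verticialSubgroups c𝒢 v₂ → K₁ ≠ H₁ → K₁ ⊓ H₁ ≠ ⊥ →
      ∃ (w₁ w₂ : ℋ.graph.Vertex) (K₂ H₂ : Subgroup cℋ.G), K₂ ∈ verticialSubgroups cℋ w₁ ∧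
        H₂ ∈ verticialSubgroups cℋ w₂ ∧ K₂ ≠ H₂ ∧ MapsOntoOpenSubgroupOf φ.toMonoidHom K₁ K₂ ∧
        MapsOntoOpenSubgroupOf φ.toMonoidHom H₁ H₂ :=
  compatOpenShadow_of_compatVAt verticialInjective_holds verticialDistinct_holds h𝒢iii
    (maximalCompactIffVerticialAt_of_compactInVerticialAt h𝒢iii)
    (maximalCompactIffVerticialAt_of_compactInVerticialAt hℋiii) h𝒢 hℋ c𝒢 cℋ F φ hF hV hE

/-- **The literal shadows with openness of an induced homomorphism, at the pair** (chart halves of the producer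
data `hιgeomV`, `hιgeomE` of the umbrella, for completeness; = `shadows_of_isCompatiblyQuasiGeometric` ∘ (R0′)):
every verticial subgroup maps onto an open subgroup of a verticial subgroup, and every non-trivial edge-like
subgroup of a closed edge onto an open subgroup of a non-trivial edge-like subgroup of a closed edge.
[cite: MochizukiSemiAnbd2006, Cor 3.9 p.42] -/
theorem openShadows_of_compatVAt (h𝒢iii : CompactInVerticialAt 𝒢) (hℋiii : CompactInVerticialAt ℋ)
    (h𝒢 : Cor39Hypotheses 𝒢) (hℋ : Cor39Hypotheses ℋ) (c𝒢 : TemperedPiChart 𝒢) (cℋ : TemperedPiChart ℋ)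
    (F : Hom 𝒢 ℋ) (φ : c𝒢.G →ₜ* cℋ.G) (hF : F.IsLocallyOpen) (hV : F.CompatV c𝒢 cℋ φ)
    (hE : F.CompatE c𝒢 cℋ φ) :
    (∀ (v : 𝒢.graph.Vertex) (K : Subgroup c𝒢.G), K ∈ verticialSubgroups c𝒢 v →
      ∃ (w : ℋ.graph.Vertex) (K₂ : Subgroup cℋ.G), K₂ ∈ verticialSubgroups cℋ w ∧
        MapsOntoOpenSubgroupOf φ.toMonoidHom K K₂) ∧
    (∀ (e : 𝒢.graph.Edge) (L : Subgroup c𝒢.G), 𝒢.graph.IsClosedEdge e →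
      L ∈ edgeLikeSubgroups c𝒢 e → L ≠ ⊥ →
      ∃ (e' : ℋ.graph.Edge) (L₂ : Subgroup cℋ.G), ℋ.graph.IsClosedEdge e' ∧
        L₂ ∈ edgeLikeSubgroups cℋ e' ∧ L₂ ≠ ⊥ ∧ MapsOntoOpenSubgroupOf φ.toMonoidHom L L₂) := by
  have hq : IsCompatiblyQuasiGeometric φ :=
    isCompatiblyQuasiGeometric_of_compatAt verticialInjective_holds verticialDistinct_holds h𝒢iii
      (maximalCompactIffVerticialAt_of_compactInVerticialAt h𝒢iii)
      (maximalCompactIffVerticialAt_of_compactInVerticialAt hℋiii) h𝒢 hℋ c𝒢 cℋ F φ hF hV hE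
  obtain ⟨hVsh, hEsh, -⟩ := shadows_of_isCompatiblyQuasiGeometric
    (maximalCompactIffVerticialAt_of_compactInVerticialAt h𝒢iii)
    (maximalCompactIffVerticialAt_of_compactInVerticialAt hℋiii) h𝒢.thm37Hypotheses hℋ.thm37Hypotheses c𝒢 cℋ hq
  exact ⟨hVsh, hEsh⟩

end ProfiniteSemiGraph

end Literature.AnabelianGeometry.SemiGraphs
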